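import Mathlib
import HarnessLib

/-!
# Projection onto a closed convex cone and Moreau's decomposition theorem

Literature anchor (statements and proofs follow the source; nothing here is new mathematics):

* [HUL01] J.-B. Hiriart-Urruty, C. Lemaréchal, *Fundamentals of Convex Analysis*, Springer 2001,
  doi:10.1007/978-3-642-56468-0 (held: `lit` key `book:hiriart-urruty2001-fundamentals-convex-analysis`),
  Chapter A, §3.1: **Theorem 3.1.1** (existence, uniqueness and the variational-inequality
  characterisation (3.1.3) of the projection `p_C(x)` onto a nonempty closed convex set `C` of a
  Euclidean space), **Proposition 3.1.3** (firm non-expansiveness (3.1.5)) and (3.1.6)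
  (non-expansiveness); §3.2: **Definition 3.2.1** (polar cone
  `K° = {s : ⟪s, x⟫ ≤ 0 for all x ∈ K}`), the listed elementary properties (`K°` is a closed
  convex cone, `K ⊆ K°°`, `K ∩ K° ⊆ {0}`), **Proposition 3.2.3** (`y = p_K(x)` iff `y ∈ K`,
  `x − y ∈ K°`, `⟪x − y, y⟫ = 0` — (3.2.1)), the "semi-linearity" properties
  `p_K(x) = 0 ⟺ x ∈ K°`, `p_K(α x) = α p_K(x)` (`α ≥ 0`) (listed just before (3.2.3)),
  the identity **(3.2.3)** `p_K(x) + p_{K°}(x) = x`, and **Theorem 3.2.5 (J.-J. Moreau)**: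
  for a closed convex cone `K`, `x = x₁ + x₂` with `x₁ ∈ K`, `x₂ ∈ K°`, `⟪x₁, x₂⟫ = 0` iff
  `x₁ = p_K(x)` and `x₂ = p_{K°}(x)` (bib: HiriarturrutyLemarechal2001). The theorem is
  originally J.-J. Moreau, *Décomposition orthogonale d'un espace hilbertien selon deux cônes
  mutuellement polaires*, C. R. Acad. Sci. Paris 255 (1962) 238–240, stated there for a real
  Hilbert space, which is the generality used below.
* [OCPB16] B. O'Donoghue, E. Chu, N. Parikh, S. Boyd, *Conic optimization via operator splitting and
  homogeneous self-dual embedding*, JOTA 169 (2016) 1042–1068, arXiv:1312.3039, §3.2 (held text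
  `paper:arxiv-1312.3039`, §3.2.1 "Eliminating dual variables"): the decomposition in the
  dual-cone form used by first-order conic solvers, `x = Π_C(x) + Π_{−C*}(x)` with the two terms
  orthogonal, "rewritten as `x = Π_C(x) − Π_{C*}(−x)`" (bib: OdonoghueEtAl2016).

Everything is proved; there are no named facts and no `sorry`.

## What is formalised

`E` is a real inner product space which is complete (a real Hilbert space); `K : ProperCone ℝ E` is
Mathlib's bundled nonempty closed convex cone. We write `proj K x` for the projection `p_K(x)`
(the unique nearest point of `K` to `x`, obtained from Mathlib's
`exists_norm_eq_iInf_of_complete_convex`) and `polar K` for the polar cone `K°`, bundled again as a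
`ProperCone` (it is `ProperCone.innerDual (−K)`; `mem_polar`). Mathlib's dual cone
`K* = ProperCone.innerDual K = {y : 0 ≤ ⟪x, y⟫ ∀ x ∈ K}` is `−K°` (`mem_polar_iff_neg_mem_innerDual`).

* §3.1 for the cone `K`: `proj_mem`, `norm_sub_proj_le` (nearest point), the variational
  inequality `inner_sub_proj_le_zero` (`⟪x − p_K x, w − p_K x⟫ ≤ 0` for `w ∈ K`, Thm 3.1.1 (3.1.3)),
  uniqueness `eq_proj_of_inner_le_zero` / `eq_proj_iff_inner_le_zero`, firm non-expansiveness
  `norm_sub_sq_le_inner` (Prop 3.1.3) and non-expansiveness `norm_proj_sub_proj_le` ((3.1.6)).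
* §3.2: `mem_polar` (Def 3.2.1), `le_polar_polar` (`K ≤ K°°`), `eq_zero_of_mem_of_mem_polar`
  (`K ∩ K° ⊆ {0}`), `inner_sub_proj_self` (`⟪x − p_K x, p_K x⟫ = 0`), `sub_proj_mem_polar`
  (`x − p_K x ∈ K°`), **Prop 3.2.3** `eq_proj_iff`, `proj_eq_self_iff` (`p_K x = x ⟺ x ∈ K`),
  `proj_eq_zero_iff` (`p_K x = 0 ⟺ x ∈ K°`), `proj_smul` (`α ≥ 0`), **(3.2.3)** `proj_polar_eq`
  (`p_{K°} x = x − p_K x`) and `proj_add_proj_polar`, orthogonality `inner_proj_proj_polar`, the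
  Pythagorean split `norm_sq_eq` (`‖x‖² = ‖p_K x‖² + ‖p_{K°} x‖²`), and **Thm 3.2.5** `moreau_iff`.
* [OCPB16, §3.2] dual-cone form: `mem_polar_iff_neg_mem_innerDual` (`y ∈ K° ⟺ −y ∈ K*`),
  `proj_polar_eq_neg_proj_innerDual_neg` (`p_{K°}(x) = −p_{K*}(−x)`) and `moreau_dual_form`
  (`x = p_K(x) − p_{K*}(−x)`), `inner_proj_proj_innerDual_neg` (`⟪p_K(x), p_{K*}(−x)⟫ = 0`).

Deviations: [HUL01] works in `ℝⁿ`; here `E` is any real Hilbert space (Moreau's setting), the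
only input being the existence of nearest points in complete convex sets. The general closed convex
*set* results of §3.1 are only stated for cones (the case needed for §3.2); the tree's
`Literature/Analysis/Convex/ProximalMap.lean` has the proximal map of a finite convex function and
`Literature/LinearAlgebra/Matrix/NearestPositiveSemidefinite.lean` has the special case `K = S₊ⁿ`
(PSD cone, Frobenius inner product: `moreau_exists`, `moreau_unique`, `polar_psdCone`); the
present file is the abstract cone version those computations instantiate, and the one behind the
cone-projection step of the splitting conic solvers (`u ⊥ v` iterates).
-/

open scoped RealInnerProductSpace
open Set Pointwise

namespace Literature.Analysis.Convex.MoreauDecomposition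

variable {E : Type*} [NormedAddCommGroup E] [InnerProductSpace ℝ E] [CompleteSpace E]
variable {K : ProperCone ℝ E} {x y w : E}

/-! ## The polar cone (Definition 3.2.1) -/

/-- The **polar cone** `K° = {y : ⟪x, y⟫ ≤ 0 for all x ∈ K}` of a closed convex cone `K`, bundled
as a closed convex cone (it is the inner dual cone of `−K`).
[cite: HiriarturrutyLemarechal2001, §A.3.2, Def. 3.2.1] -/
noncomputable def polar (K : ProperCone ℝ E) : ProperCone ℝ E :=
  ProperCone.innerDual (-(K : Set E))

/-- Membership in the polar cone: `y ∈ K° ⟺ ⟪x, y⟫ ≤ 0` for all `x ∈ K`.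
[cite: HiriarturrutyLemarechal2001, §A.3.2, Def. 3.2.1] -/
theorem mem_polar : y ∈ polar K ↔ ∀ ⦃x : E⦄, x ∈ K → ⟪x, y⟫ ≤ 0 := by
  unfold polar
  rw [ProperCone.mem_innerDual]
  constructor
  · intro h x hx
    have h' := @h (-x) (by simpa using hx)
    rw [inner_neg_left] at h'
    linarith
  · intro h x hx
    have hx' : -x ∈ K := by simpa using hx
    have h' := h hx'
    rw [inner_neg_left] at h'
    linarith

/-- Membership in the polar cone, symmetric form: `y ∈ K° ⟺ ⟪y, x⟫ ≤ 0` for all `x ∈ K`.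
[cite: HiriarturrutyLemarechal2001, §A.3.2, Def. 3.2.1] -/
theorem mem_polar' : y ∈ polar K ↔ ∀ ⦃x : E⦄, x ∈ K → ⟪y, x⟫ ≤ 0 := by
  rw [mem_polar]
  constructor
  · intro h x hx
    rw [real_inner_comm]
    exact h hx
  · intro h x hx
    rw [real_inner_comm]
    exact h hx

/-- The polar cone is `−K*`: `y ∈ K° ⟺ −y ∈ K*`, where `K* = ProperCone.innerDual K` is Mathlib's
(inner) dual cone `{y : 0 ≤ ⟪x, y⟫ ∀ x ∈ K}`. This is the dictionary between [HUL01] (polar cones)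
and the dual-cone convention of [OCPB16].
[cite: HiriarturrutyLemarechal2001, §A.3.2, Def. 3.2.1; OdonoghueEtAl2016, §3.2] -/
theorem mem_polar_iff_neg_mem_innerDual :
    y ∈ polar K ↔ -y ∈ ProperCone.innerDual (K : Set E) := by
  rw [mem_polar, ProperCone.mem_innerDual]
  constructor
  · intro h x hx
    have h' := h hx
    rw [inner_neg_right]
    linarith
  · intro h x hx
    have h' := h hx
    rw [inner_neg_right] at h'
    linarith

/-- `K ⊆ K°°` (the easy half of the bipolar relation).
[cite: HiriarturrutyLemarechal2001, §A.3.2, after Def. 3.2.1] -/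
theorem le_polar_polar (K : ProperCone ℝ E) : K ≤ polar (polar K) := by
  intro x hx
  rw [mem_polar]
  intro y hy
  rw [real_inner_comm]
  exact (mem_polar.1 hy) hx

/-- `K ∩ K° ⊆ {0}`: the only possible element of `K ∩ K°` is `0`.
[cite: HiriarturrutyLemarechal2001, §A.3.2, after Def. 3.2.1] -/
theorem eq_zero_of_mem_of_mem_polar (hx : x ∈ K) (hx' : x ∈ polar K) : x = 0 :=
  real_inner_self_nonpos.1 ((mem_polar.1 hx') hx)

/-! ## The projection onto `K` (§3.1 for a closed convex cone) -/

/-- Existence of a nearest point of the nonempty closed convex cone `K` to `x` (Mathlib's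
`exists_norm_eq_iInf_of_complete_convex`; [HUL01] §3.1, existence part of the discussion before
Theorem 3.1.1). [cite: HiriarturrutyLemarechal2001, §A.3.1, Thm. 3.1.1] -/
theorem exists_norm_sub_eq_iInf (K : ProperCone ℝ E) (x : E) :
    ∃ p ∈ (K : Set E), ‖x - p‖ = ⨅ w : (K : Set E), ‖x - w‖ :=
  exists_norm_eq_iInf_of_complete_convex K.nonempty K.isClosed.isComplete K.convex x

/-- The **projection** `p_K(x)` of `x` onto the closed convex cone `K`: a nearest point of `K`
(unique by `eq_proj_of_inner_le_zero`). [cite: HiriarturrutyLemarechal2001, §A.3.1, Thm. 3.1.1] -/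
noncomputable def proj (K : ProperCone ℝ E) (x : E) : E :=
  (exists_norm_sub_eq_iInf K x).choose

/-- `p_K(x) ∈ K`. [cite: HiriarturrutyLemarechal2001, §A.3.1, Thm. 3.1.1] -/
theorem proj_mem : proj K x ∈ K :=
  (exists_norm_sub_eq_iInf K x).choose_spec.1

/-- `‖x − p_K(x)‖ = inf_{w ∈ K} ‖x − w‖`. [cite: HiriarturrutyLemarechal2001, §A.3.1, Thm. 3.1.1] -/
theorem norm_sub_proj_eq_iInf : ‖x - proj K x‖ = ⨅ w : (K : Set E), ‖x - w‖ :=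
  (exists_norm_sub_eq_iInf K x).choose_spec.2

/-- `p_K(x)` is a nearest point: `‖x − p_K(x)‖ ≤ ‖x − y‖` for every `y ∈ K`.
[cite: HiriarturrutyLemarechal2001, §A.3.1, Thm. 3.1.1] -/
theorem norm_sub_proj_le (hy : y ∈ K) : ‖x - proj K x‖ ≤ ‖x - y‖ := by
  rw [norm_sub_proj_eq_iInf]
  have hb : BddBelow (Set.range fun w : (K : Set E) => ‖x - w‖) :=
    ⟨0, by rintro _ ⟨w, rfl⟩; exact norm_nonneg _⟩
  exact ciInf_le hb ⟨y, hy⟩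

/-- **Variational inequality (3.1.3)**: `⟪x − p_K(x), w − p_K(x)⟫ ≤ 0` for all `w ∈ K`.
[cite: HiriarturrutyLemarechal2001, §A.3.1, Thm. 3.1.1] -/
theorem inner_sub_proj_le_zero (hw : w ∈ K) : ⟪x - proj K x, w - proj K x⟫ ≤ 0 :=
  (norm_eq_iInf_iff_real_inner_le_zero K.convex proj_mem).1 norm_sub_proj_eq_iInf w hw

/-- **Uniqueness / sufficiency of (3.1.3)**: a point `y ∈ K` with `⟪x − y, w − y⟫ ≤ 0` for all
`w ∈ K` is the projection `p_K(x)`. [cite: HiriarturrutyLemarechal2001, §A.3.1, Thm. 3.1.1] -/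
theorem eq_proj_of_inner_le_zero (hy : y ∈ K) (h : ∀ w ∈ K, ⟪x - y, w - y⟫ ≤ 0) :
    y = proj K x := by
  have h1 : ⟪x - y, proj K x - y⟫ ≤ 0 := h _ proj_mem
  have h2 : ⟪x - proj K x, y - proj K x⟫ ≤ 0 := inner_sub_proj_le_zero hy
  have e1 : ⟪proj K x - y, proj K x - y⟫ = ⟪(x - y) + (proj K x - x), proj K x - y⟫ := by
    congr 1
    abel
  have e2 : ⟪proj K x - x, proj K x - y⟫ = ⟪x - proj K x, y - proj K x⟫ := by
    rw [← inner_neg_neg, neg_sub, neg_sub]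
  have h3 : ⟪proj K x - y, proj K x - y⟫ ≤ 0 := by
    rw [e1, inner_add_left, e2]
    linarith
  have h4 : proj K x - y = 0 := real_inner_self_nonpos.1 h3
  exact (sub_eq_zero.1 h4).symm

/-- **Theorem 3.1.1 for a cone**: `y = p_K(x)` iff `y ∈ K` and `⟪x − y, w − y⟫ ≤ 0` for all `w ∈ K`.
[cite: HiriarturrutyLemarechal2001, §A.3.1, Thm. 3.1.1] -/
theorem eq_proj_iff_inner_le_zero :
    y = proj K x ↔ y ∈ K ∧ ∀ w ∈ K, ⟪x - y, w - y⟫ ≤ 0 := by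
  constructor
  · rintro rfl
    exact ⟨proj_mem, fun w hw => inner_sub_proj_le_zero hw⟩
  · rintro ⟨hy, h⟩
    exact eq_proj_of_inner_le_zero hy h

/-- **Firm non-expansiveness (Proposition 3.1.3, (3.1.5))**:
`‖p_K(x) − p_K(y)‖² ≤ ⟪p_K(x) − p_K(y), x − y⟫`.
[cite: HiriarturrutyLemarechal2001, §A.3.1, Prop. 3.1.3] -/
theorem norm_sub_sq_le_inner (x y : E) :
    ‖proj K x - proj K y‖ ^ 2 ≤ ⟪proj K x - proj K y, x - y⟫ := by
  have h1 : ⟪x - proj K x, proj K y - proj K x⟫ ≤ 0 := inner_sub_proj_le_zero proj_mem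
  have h2 : ⟪y - proj K y, proj K x - proj K y⟫ ≤ 0 := inner_sub_proj_le_zero proj_mem
  have e1 : ⟪x - proj K x, proj K y - proj K x⟫ = -⟪x - proj K x, proj K x - proj K y⟫ := by
    rw [← inner_neg_right, neg_sub]
  have e2 : ⟪proj K x - proj K y, x - y⟫ - ‖proj K x - proj K y‖ ^ 2 =
      ⟪x - proj K x, proj K x - proj K y⟫ - ⟪y - proj K y, proj K x - proj K y⟫ := by
    rw [← real_inner_self_eq_norm_sq, ← real_inner_comm (proj K x - proj K y) (x - y),
      ← inner_sub_left, ← inner_sub_left]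
    congr 1
    abel
  linarith

/-- **Non-expansiveness (3.1.6)**: `‖p_K(x) − p_K(y)‖ ≤ ‖x − y‖`.
[cite: HiriarturrutyLemarechal2001, §A.3.1, (3.1.6)] -/
theorem norm_proj_sub_proj_le (x y : E) : ‖proj K x - proj K y‖ ≤ ‖x - y‖ := by
  have h := norm_sub_sq_le_inner (K := K) x y
  have hcs := real_inner_le_norm (proj K x - proj K y) (x - y)
  by_cases h0 : ‖proj K x - proj K y‖ = 0
  · rw [h0]
    exact norm_nonneg _
  · have hpos : 0 < ‖proj K x - proj K y‖ := lt_of_le_of_ne (norm_nonneg _) (Ne.symm h0)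
    have h' : ‖proj K x - proj K y‖ * ‖proj K x - proj K y‖ ≤ ‖x - y‖ * ‖proj K x - proj K y‖ := by
      nlinarith
    exact le_of_mul_le_mul_right h' hpos

/-! ## Projection onto a cone and the polar cone (§3.2) -/

/-- `⟪x − p_K(x), p_K(x)⟫ = 0` (first half of (3.2.1): take `y = α p_K(x)` in (3.2.2) with
`α = 0` and `α = 2`). [cite: HiriarturrutyLemarechal2001, §A.3.2, Prop. 3.2.3] -/
theorem inner_sub_proj_self : ⟪x - proj K x, proj K x⟫ = 0 := by
  have h0 : ⟪x - proj K x, 0 - proj K x⟫ ≤ 0 := inner_sub_proj_le_zero K.zero_mem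
  have h2 : ⟪x - proj K x, (proj K x + proj K x) - proj K x⟫ ≤ 0 :=
    inner_sub_proj_le_zero (add_mem proj_mem proj_mem)
  rw [zero_sub, inner_neg_right] at h0
  rw [add_sub_cancel_right] at h2
  linarith

/-- `x − p_K(x) ∈ K°` (second half of (3.2.1)).
[cite: HiriarturrutyLemarechal2001, §A.3.2, Prop. 3.2.3] -/
theorem sub_proj_mem_polar : x - proj K x ∈ polar K := by
  rw [mem_polar']
  intro w hw
  have h := inner_sub_proj_le_zero (x := x) hw
  rwa [inner_sub_right, inner_sub_proj_self, sub_zero] at h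

/-- **Proposition 3.2.3**: for a closed convex cone `K`, `y = p_K(x)` iff
`y ∈ K`, `x − y ∈ K°` and `⟪x − y, y⟫ = 0` ((3.2.1)).
[cite: HiriarturrutyLemarechal2001, §A.3.2, Prop. 3.2.3] -/
theorem eq_proj_iff : y = proj K x ↔ y ∈ K ∧ x - y ∈ polar K ∧ ⟪x - y, y⟫ = 0 := by
  constructor
  · rintro rfl
    exact ⟨proj_mem, sub_proj_mem_polar, inner_sub_proj_self⟩
  · rintro ⟨hy, hpol, horth⟩
    apply eq_proj_of_inner_le_zero hy
    intro w hw
    rw [inner_sub_right, horth, sub_zero]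
    exact (mem_polar'.1 hpol) hw

/-- `p_K(x) = x ⟺ x ∈ K`. [cite: HiriarturrutyLemarechal2001, §A.3.2, Prop. 3.2.3] -/
theorem proj_eq_self_iff : proj K x = x ↔ x ∈ K := by
  constructor
  · intro h
    rw [← h]
    exact proj_mem
  · intro hx
    symm
    refine eq_proj_iff.2 ⟨hx, ?_, ?_⟩
    · rw [sub_self]
      exact (polar K).zero_mem
    · rw [sub_self, inner_zero_left]

/-- `p_K(x) = 0 ⟺ x ∈ K°` (first of the "semi-linearity" properties listed before (3.2.3)).
[cite: HiriarturrutyLemarechal2001, §A.3.2, before (3.2.3)] -/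
theorem proj_eq_zero_iff : proj K x = 0 ↔ x ∈ polar K := by
  constructor
  · intro h
    have h' := sub_proj_mem_polar (K := K) (x := x)
    rwa [h, sub_zero] at h'
  · intro hx
    symm
    refine eq_proj_iff.2 ⟨K.zero_mem, ?_, ?_⟩
    · rwa [sub_zero]
    · rw [inner_zero_right]

/-- Positive homogeneity `p_K(t x) = t p_K(x)` for `t ≥ 0` (second "semi-linearity" property).
[cite: HiriarturrutyLemarechal2001, §A.3.2, before (3.2.3)] -/
theorem proj_smul {t : ℝ} (ht : 0 ≤ t) : proj K (t • x) = t • proj K x := by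
  symm
  refine eq_proj_iff.2 ⟨K.smul_mem proj_mem ht, ?_, ?_⟩
  · rw [← smul_sub]
    exact (polar K).smul_mem sub_proj_mem_polar ht
  · rw [← smul_sub, inner_smul_left, inner_smul_right, inner_sub_proj_self]
    simp

/-- **(3.2.3)**, solved for the polar part: `p_{K°}(x) = x − p_K(x)`.
[cite: HiriarturrutyLemarechal2001, §A.3.2, (3.2.3)] -/
theorem proj_polar_eq : proj (polar K) x = x - proj K x := by
  symm
  refine eq_proj_iff.2 ⟨sub_proj_mem_polar, ?_, ?_⟩
  · rw [sub_sub_cancel]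
    exact le_polar_polar K proj_mem
  · rw [sub_sub_cancel, real_inner_comm]
    exact inner_sub_proj_self

/-- **(3.2.3)**: `p_K(x) + p_{K°}(x) = x`. [cite: HiriarturrutyLemarechal2001, §A.3.2, (3.2.3)] -/
theorem proj_add_proj_polar : proj K x + proj (polar K) x = x := by
  rw [proj_polar_eq, add_sub_cancel]

/-- The two parts are orthogonal: `⟪p_K(x), p_{K°}(x)⟫ = 0`.
[cite: HiriarturrutyLemarechal2001, §A.3.2, Thm. 3.2.5] -/
theorem inner_proj_proj_polar : ⟪proj K x, proj (polar K) x⟫ = 0 := by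
  rw [proj_polar_eq, real_inner_comm]
  exact inner_sub_proj_self

/-- Pythagorean split `‖x‖² = ‖p_K(x)‖² + ‖p_{K°}(x)‖²` (orthogonality of the Moreau parts).
[cite: HiriarturrutyLemarechal2001, §A.3.2, Thm. 3.2.5] -/
theorem norm_sq_eq : ‖x‖ ^ 2 = ‖proj K x‖ ^ 2 + ‖proj (polar K) x‖ ^ 2 := by
  have h := norm_add_sq_eq_norm_sq_add_norm_sq_real (inner_proj_proj_polar (K := K) (x := x))
  rw [proj_add_proj_polar] at h
  simpa only [sq] using h

/-- **Theorem 3.2.5 (J.-J. Moreau)**: for a closed convex cone `K` and `x, x₁, x₂`,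
`x = x₁ + x₂` with `x₁ ∈ K`, `x₂ ∈ K°`, `⟪x₁, x₂⟫ = 0` iff `x₁ = p_K(x)` and `x₂ = p_{K°}(x)`.
[cite: HiriarturrutyLemarechal2001, §A.3.2, Thm. 3.2.5] -/
theorem moreau_iff (K : ProperCone ℝ E) (x x₁ x₂ : E) :
    (x = x₁ + x₂ ∧ x₁ ∈ K ∧ x₂ ∈ polar K ∧ ⟪x₁, x₂⟫ = 0) ↔
      (x₁ = proj K x ∧ x₂ = proj (polar K) x) := by
  constructor
  · rintro ⟨rfl, h1, h2, h12⟩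
    have e1 : x₁ = proj K (x₁ + x₂) := by
      refine eq_proj_iff.2 ⟨h1, ?_, ?_⟩
      · rwa [add_sub_cancel_left]
      · rw [add_sub_cancel_left, real_inner_comm]
        exact h12
    refine ⟨e1, ?_⟩
    rw [proj_polar_eq, ← e1, add_sub_cancel_left]
  · rintro ⟨rfl, rfl⟩
    exact ⟨proj_add_proj_polar.symm, proj_mem, proj_mem, inner_proj_proj_polar⟩

/-- Existence half of Moreau's theorem as a standalone statement: every `x` splits as
`x = x₁ + x₂` with `x₁ ∈ K`, `x₂ ∈ K°`, `⟪x₁, x₂⟫ = 0`.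
[cite: HiriarturrutyLemarechal2001, §A.3.2, Thm. 3.2.5] -/
theorem exists_moreau_decomposition (K : ProperCone ℝ E) (x : E) :
    ∃ x₁ x₂ : E, x = x₁ + x₂ ∧ x₁ ∈ K ∧ x₂ ∈ polar K ∧ ⟪x₁, x₂⟫ = 0 :=
  ⟨proj K x, proj (polar K) x, (moreau_iff K x _ _).2 ⟨rfl, rfl⟩⟩

/-- Uniqueness half of Moreau's theorem: two orthogonal splittings along `K` and `K°` coincide.
[cite: HiriarturrutyLemarechal2001, §A.3.2, Thm. 3.2.5] -/
theorem moreau_unique {x₁ x₂ x₁' x₂' : E} (h : x₁ + x₂ = x₁' + x₂')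
    (h1 : x₁ ∈ K) (h2 : x₂ ∈ polar K) (h12 : ⟪x₁, x₂⟫ = 0)
    (h1' : x₁' ∈ K) (h2' : x₂' ∈ polar K) (h12' : ⟪x₁', x₂'⟫ = 0) :
    x₁ = x₁' ∧ x₂ = x₂' := by
  obtain ⟨e1, e2⟩ := (moreau_iff K (x₁ + x₂) x₁ x₂).1 ⟨rfl, h1, h2, h12⟩
  obtain ⟨e1', e2'⟩ := (moreau_iff K (x₁ + x₂) x₁' x₂').1 ⟨h, h1', h2', h12'⟩
  exact ⟨e1.trans e1'.symm, e2.trans e2'.symm⟩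

/-! ## The dual-cone form used by conic splitting solvers ([OCPB16] §3.2) -/

/-- `p_{K°}(x) = −p_{K*}(−x)`, where `K* = ProperCone.innerDual K = −K°` is the dual cone.
[cite: OdonoghueEtAl2016, §3.2; HiriarturrutyLemarechal2001, §A.3.2, (3.2.3)] -/
theorem proj_polar_eq_neg_proj_innerDual_neg :
    proj (polar K) x = -proj (ProperCone.innerDual (K : Set E)) (-x) := by
  have hq : proj (polar K) x ∈ polar K := proj_mem
  have e : -proj (polar K) x = proj (ProperCone.innerDual (K : Set E)) (-x) := by
    refine eq_proj_iff.2 ⟨?_, ?_, ?_⟩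
    · rw [mem_polar_iff_neg_mem_innerDual] at hq
      exact hq
    · rw [sub_neg_eq_add, neg_add_eq_sub, proj_polar_eq, sub_sub_cancel_left, mem_polar']
      intro d hd
      rw [inner_neg_left, neg_nonpos]
      exact (ProperCone.mem_innerDual.1 hd) proj_mem
    · rw [sub_neg_eq_add, neg_add_eq_sub, proj_polar_eq, sub_sub_cancel_left, inner_neg_left,
        inner_neg_right, neg_neg, ← proj_polar_eq]
      exact inner_proj_proj_polar
  rw [← e, neg_neg]

/-- **Moreau decomposition, dual-cone form**: `x = p_K(x) − p_{K*}(−x)`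
("`x = Π_C(x) + Π_{−C*}(x)` … can be rewritten as `x = Π_C(x) − Π_{C*}(−x)`").
[cite: OdonoghueEtAl2016, §3.2; HiriarturrutyLemarechal2001, §A.3.2, Thm. 3.2.5] -/
theorem moreau_dual_form (K : ProperCone ℝ E) (x : E) :
    x = proj K x - proj (ProperCone.innerDual (K : Set E)) (-x) := by
  rw [sub_eq_add_neg, ← proj_polar_eq_neg_proj_innerDual_neg, proj_add_proj_polar]

/-- "and moreover, the two terms on the right-hand side are orthogonal":
`⟪p_K(x), p_{K*}(−x)⟫ = 0`.
[cite: OdonoghueEtAl2016, §3.2; HiriarturrutyLemarechal2001, §A.3.2, Thm. 3.2.5] -/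
theorem inner_proj_proj_innerDual_neg :
    ⟪proj K x, proj (ProperCone.innerDual (K : Set E)) (-x)⟫ = 0 := by
  have h := inner_proj_proj_polar (K := K) (x := x)
  rw [proj_polar_eq_neg_proj_innerDual_neg, inner_neg_right, neg_eq_zero] at h
  exact h

end Literature.Analysis.Convex.MoreauDecomposition
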